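import Summits.QuantumFields.YangMills.Theorems.BalabanUVNodesN15CurvedGluingCubeDressedGeneralLeftFactors
import Summits.QuantumFields.YangMills.Theorems.BalabanUVNodesN15CurvedGluingCubeSandwichDefect
import Summits.QuantumFields.YangMills.Theorems.BalabanUVNodesN15TwoSpacingGluingInputLocalized
import HarnessLib

/-!
# Route «BalabanUVNodes» (cluster K4 «SpineRates»), Track-A DAG node N15 = NE2, BACKGROUND LAYER — THE DRESSED TAIL: the locality defect of the dressed smooth-cut cube,
# `M_h(Δ − 𝒱)X = M_h + E_□`, `E_□ = (−M_hN_LM_{1−χ̃}N)∘(1 + 𝒱X)` EXACTLY, its OUTPUT-localized letter `1_S(y)·ε₀(1 − βRc_r²)⁻¹e^{−ρ₂d}` and η-defect — the `hE`∕`hE′`∕`hDE` rows of file 32's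
# gluing with per-cube locality defects

Cell `pub-ymgap`, seat `pub-ymgap-dag-n15-w3` (WIDTH SEAT 3∕3 on node N15, director-ym №197 ∕ HUMAN RULING D-0149; plan `W-SEAT-START-LIST.md` §n15 item 3 «LG-vector + background layers at
GENERAL small-field U» — thirty-third piece).  `bears_on: R4∕N15 · K3⁷ SpineGivenEndpointR13SepCoPH (stmt-QuantumFields-20544)`.  Filed `--kind proof --supports stmt-QuantumFields-20544 --as
helper` — COUNT-NEUTRAL.  Theorems only; 0 `sorry`.  Imports BY NAME file 30 `…CubeDressedGeneralLeftFactors` (`neumannFactor_eq`, `idef_id_id`; through it file 23 `mulOp_comp_sub_comp_dressedV_of_defect`,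
`V_comp_dressedV`, `hasMaj_dressedV_pair`, file 24 `hasMaj_V_bgPropVE`), file 22 `…CubeSandwichDefect` (`mulOp_comp_comp_sandwich_of_hloc`), dag-n15-c FILE 57 `…TwoSpacingGluingInputLocalized`
(`hasMaj_comp_exp_out`); lit `idef_comp`∕`idef_add`, `hasMaj_comp_exp`; nothing in the tree is modified.

WHY.  File 32 glues cubes that invert the glued operator against their partition functions only modulo a defect, `M_{h_□}ΔG_□ = M_{h_□} + E_□`, from OUTPUT-localized defect rows
`E_□ ≤ 1_{S_□}(y)·εe^{−δd}` (+ fine twins and `𝔇(E′_□, E_□)`).  For the dressed smooth-cut cube of files 23∕31 — `G₀ = M_{χ̃}N_□`, `X = pr₀X̂`, glued operator `Δ − 𝒱` with `𝒱 = V̂∘jet` — the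
defect is EXPLICIT: the bare cube inverts `Δ = L + N_L` against `h` exactly (`M_hΔN_□ = M_h`, dag-n15-a), the local part cannot cross the bump's collar (`M_hLM_{1−χ̃} = 0`), so file 22 gives
`M_hΔG₀ = M_h + T`, `T := (−M_hN_LM_{1−χ̃})∘N_□` (the nonlocal tail across the margin — [B5] (1.120)'s `P(dh)` phenomenon), and file 23's defect slot dresses it: `M_h(Δ − 𝒱)X = M_h + T∘(1 + 𝒱X)`.
THIS FILE types that identity and the rows file 32 consumes: with the tail's two-sided letter `T ≤ 1_S1_S·ε₀e^{−ρ_Td}` DISPLAYED (dag-n15-a's images geometry ∕ FILE 68's far sandwich supply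
`ε₀ ~ e^{−δ′m₀}`), `E_□ = T + T∘V̂∘X̂ ≤ 1_S(y)·ε₀(1 − βRc_r²)⁻¹e^{−ρ₂d}` (file 24's `V̂X̂` letter, FILE 57's one-sided composition, file 30's `1 + q(1 − q)⁻¹ = (1 − q)⁻¹`), and its η-defect by
the exact Leibniz split `𝔇(F′(1 + V̂′X̂′), F(1 + V̂X̂)) = F′(V̂′𝔇(X̂′, X̂) + 𝔇(V̂′, V̂)X̂) + 𝔇(F′, F)(1 + V̂X̂)` for ANY `F` (file 30's split is the case `F = T∘G₀`).

* §1 ★ `mulOp_comp_sub_comp_dressedV_tail` (the identity), `comp_onePlus_dressedV_eq` (`F∘(1 + 𝒱X) = F + F∘V̂∘X̂`), ★ `idef_comp_onePlusVX_eq` (exact two-grid Leibniz for any `F`);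
* §2 ★★ `hasMaj_comp_onePlusVX_out` (`F ≤ 1_S1_S·ε₀e^{−ρ_Td}` ⟹ `F∘(1 + V̂X̂) ≤ 1_S(y)·ε₀(1 − βRc_r²)⁻¹e^{−ρ₂d}`), ★★ `hasMaj_dressedTail_out` (= file 32's `hE` for the dressed smooth-cut cube);
* §3 ★★ `hasMaj_idef_comp_onePlusVX_out` (η-defect, pair letters `A, A_D` displayed as in files 28∕30), ★★ `hasMaj_idef_dressedTail_out` (= file 32's `hDE`).

HONEST FRAMING ∕ LIMITS.  Finite-dimensional resolvent algebra + block-majorant bookkeeping over DISPLAYED rows (the tail's letters∕defect, the flat pieces' letters, the perturbation's `R, δ_V, o`,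
the pair letters `A, A_D`); the tail letter itself (images geometry, margin) is NOT proved here; nothing of [B5]∕[B6]∕[B9] asserted ((1.120)–(1.123) p.37, (2.36)–(2.38) p.229, (2.91) p.239,
(3.63)–(3.65) pp.402–403, Thm 3.14 = SHAPES ∕ MECHANISM ∕ TEMPLATE).  NE2⁺ NOT PRINTED, NOT proved; N15 NOT discharged; counts of record UNMOVED (typed 28∕28 · discharged 5∕27); one finite 𝕋⁴
at fixed ε — NOT infinite volume, NOT OS on ℝ⁴, NOT a mass gap, NOT Clay; R4 closes the conditional finite-𝕋⁴ rung `BalabanLadder.UV` only.  Restate-immune (no Theses import).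
-/

set_option autoImplicit false

noncomputable section
open scoped BigOperators
open Finset

namespace Summit.QuantumFields.YangMills.BalabanUVNodes.N15.CurvedSpecies

open Literature.MathematicalPhysics.QuantumFieldTheory.Balaban1983to89
open Literature.MathematicalPhysics.QuantumFieldTheory.Balaban1983to89.B11SectG (BlockNorm HasMaj RowSum hasMaj_comp_exp)
open Literature.MathematicalPhysics.QuantumFieldTheory.Balaban1983to89.B6RandomWalk (Triangle254)
open Literature.MathematicalPhysics.QuantumFieldTheory.Balaban1983to89.T4EtaRateDefect (idef idef_apply idef_comp idef_add)
open Literature.MathematicalPhysics.QuantumFieldTheory.Balaban1983to89.T4EtaRateCoeffDefect (pull pull_apply)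
open Literature.MathematicalPhysics.QuantumFieldTheory.Balaban1983to89.B6Prop26Gluing (mulOp mulOp_apply ind ind_nonneg)
open Summit.QuantumFields.YangMills.BalabanUVNodes.N15.MatrixSpecies (liftBlk liftMap)
open Summit.QuantumFields.YangMills.BalabanUVNodes.N15.BackgroundModel (kappa_ofBlocks)
open Summit.QuantumFields.YangMills.BalabanUVNodes.N15.BackgroundLayer (stack projO blkPair liftPair hasMaj_stack hasMaj_projO_comp bgPropV)
open Summit.QuantumFields.YangMills.BalabanUVNodes.N15.Gluing (hasMaj_comp_exp_out)

/-! ## §1 Algebra: the dressed tail, exactly -/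

section Algebra

variable {Y K : Type} [Fintype Y] [Fintype K] [DecidableEq Y] [DecidableEq K] {N : (Y → ℝ) →ₗ[ℝ] (Y → ℝ)} {D Dq : K → (Y → ℝ) →ₗ[ℝ] (Y → ℝ)}
  {V : (Y × Option K → ℝ) →ₗ[ℝ] (Y → ℝ)} {χt : Y → ℝ}

/-- ★ **THE LOCALITY DEFECT OF THE DRESSED SMOOTH-CUT CUBE, EXACTLY**: the bare cube inverts `Δ = L + N_L` against `h` (`M_hΔN = M_h`), the local part cannot cross the collar
(`M_hLM_{1−χ̃} = 0`), the jet `D_j = Dq_j∘(M_χ̃N)`, the unit ⟹ `M_h∘(Δ − 𝒱)∘X = M_h + ((−M_hN_LM_{1−χ̃})∘N)∘(1 + 𝒱∘X)` with `𝒱 = V̂∘jet`, `X = pr₀X̂` (file 22 + file 23).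
[cite: Balaban1984PropagatorsII, (2.37)–(2.38) p.229, (2.91) p.239 (mechanism); Balaban1984PropagatorsI, (1.120)–(1.123) p.37 (the nonlocal term: shape); Balaban1985BackgroundPropagators, (3.62)–(3.65) pp.402–403] -/
theorem mulOp_comp_sub_comp_dressedV_tail {Δ L NL : (Y → ℝ) →ₗ[ℝ] (Y → ℝ)} {h : Y → ℝ} (hloc0 : mulOp h ∘ₗ Δ ∘ₗ N = mulOp h) (hΔ : Δ = L + NL)
    (hL : mulOp h ∘ₗ L ∘ₗ mulOp (1 - χt) = 0) (hDq : ∀ j, D j = Dq j ∘ₗ (mulOp χt ∘ₗ N)) (hunit : IsUnit (1 - LinearMap.toMatrix' (stack (mulOp χt ∘ₗ N) D ∘ₗ V))) :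
    mulOp h ∘ₗ (Δ - V ∘ₗ stack LinearMap.id Dq) ∘ₗ (projO none ∘ₗ bgPropV (stack (mulOp χt ∘ₗ N) D) V) =
      mulOp h + ((-(mulOp h ∘ₗ NL ∘ₗ mulOp (1 - χt))) ∘ₗ N) ∘ₗ (LinearMap.id + (V ∘ₗ stack LinearMap.id Dq) ∘ₗ (projO none ∘ₗ bgPropV (stack (mulOp χt ∘ₗ N) D) V)) :=
  mulOp_comp_sub_comp_dressedV_of_defect Δ ((-(mulOp h ∘ₗ NL ∘ₗ mulOp (1 - χt))) ∘ₗ N) h (mulOp_comp_comp_sandwich_of_hloc hloc0 hΔ hL) hDq hunit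

variable {G₀ : (Y → ℝ) →ₗ[ℝ] (Y → ℝ)}

/-- `F∘(1 + 𝒱∘X) = F + F∘V̂∘X̂` (`𝒱X = V̂X̂`, file 23 `V_comp_dressedV`). [cite: Balaban1985BackgroundPropagators, (3.62)–(3.63) p.402 (shape)] -/
theorem comp_onePlus_dressedV_eq (F : (Y → ℝ) →ₗ[ℝ] (Y → ℝ)) (hDq : ∀ j, D j = Dq j ∘ₗ G₀) (hunit : IsUnit (1 - LinearMap.toMatrix' (stack G₀ D ∘ₗ V))) :
    F ∘ₗ (LinearMap.id + (V ∘ₗ stack LinearMap.id Dq) ∘ₗ (projO none ∘ₗ bgPropV (stack G₀ D) V)) = F + F ∘ₗ (V ∘ₗ bgPropV (stack G₀ D) V) := by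
  rw [← V_comp_dressedV hDq hunit, LinearMap.comp_add, LinearMap.comp_id]

end Algebra

section Leibniz

variable {X X' ι J : Type} [Fintype X] [Fintype X'] [DecidableEq X] [DecidableEq X'] [Fintype ι] [DecidableEq ι] [Fintype J] [DecidableEq J] (π : X' → X)
  {G₀ : (X × ι → ℝ) →ₗ[ℝ] (X × ι → ℝ)} {D : J ⊕ J → (X × ι → ℝ) →ₗ[ℝ] (X × ι → ℝ)} {V : ((X × ι) × Option (J ⊕ J) → ℝ) →ₗ[ℝ] (X × ι → ℝ)}
  {G₀' : (X' × ι → ℝ) →ₗ[ℝ] (X' × ι → ℝ)} {D' : J ⊕ J → (X' × ι → ℝ) →ₗ[ℝ] (X' × ι → ℝ)} {V' : ((X' × ι) × Option (J ⊕ J) → ℝ) →ₗ[ℝ] (X' × ι → ℝ)}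

/-- ★ **THE EXACT TWO-GRID LEIBNIZ SPLIT FOR ANY LEFT FACTOR OF `1 + V̂X̂`**: `𝔇(F′(1 + V̂′X̂′), F(1 + V̂X̂)) = F′(V̂′𝔇(X̂′, X̂) + 𝔇(V̂′, V̂)X̂) + 𝔇(F′, F)(1 + V̂X̂)` (file 30's is the case `F = T∘G₀`).
[cite: Balaban1985BackgroundPropagators, Thm 3.14 pp.426–427 (difference template)] -/
theorem idef_comp_onePlusVX_eq (F : (X × ι → ℝ) →ₗ[ℝ] (X × ι → ℝ)) (F' : (X' × ι → ℝ) →ₗ[ℝ] (X' × ι → ℝ)) :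
    idef (pull (liftMap π ι)) (pull (liftMap π ι)) (F' ∘ₗ (LinearMap.id + V' ∘ₗ bgPropV (stack G₀' D') V')) (F ∘ₗ (LinearMap.id + V ∘ₗ bgPropV (stack G₀ D) V)) =
      F' ∘ₗ (V' ∘ₗ idef (pull (liftMap π ι)) (pull (liftPair (liftMap π ι))) (bgPropV (stack G₀' D') V') (bgPropV (stack G₀ D) V) +
          idef (pull (liftPair (liftMap π ι))) (pull (liftMap π ι)) V' V ∘ₗ bgPropV (stack G₀ D) V) +
        idef (pull (liftMap π ι)) (pull (liftMap π ι)) F' F ∘ₗ (LinearMap.id + V ∘ₗ bgPropV (stack G₀ D) V) := by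
  rw [idef_comp (pull (liftMap π ι)) (pull (liftMap π ι)) (pull (liftMap π ι)) F' (LinearMap.id + V' ∘ₗ bgPropV (stack G₀' D') V') F (LinearMap.id + V ∘ₗ bgPropV (stack G₀ D) V),
    idef_add, idef_id_id, zero_add, idef_comp (pull (liftMap π ι)) (pull (liftPair (liftMap π ι))) (pull (liftMap π ι)) V' (bgPropV (stack G₀' D') V') V (bgPropV (stack G₀ D) V)]

end Leibniz

/-! ## §2 The dressed tail's output-localized letter -/

section Rows

variable {X ι J : Type} [Fintype X] [DecidableEq X] [Fintype ι] [DecidableEq ι] [Fintype J] [DecidableEq J] {g : B6.Geometry} (blk : X → g.Site) {σ cr : ℝ}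
  {G₀ : (X × ι → ℝ) →ₗ[ℝ] (X × ι → ℝ)} {D Dq : J ⊕ J → (X × ι → ℝ) →ₗ[ℝ] (X × ι → ℝ)} {V : ((X × ι) × Option (J ⊕ J) → ℝ) →ₗ[ℝ] (X × ι → ℝ)}

/-- ★★ **ANY TWO-SIDED ROW THROUGH `1 + V̂X̂`, OUTPUT-LOCALIZED**: `F ≤ 1_S1_S·ε₀e^{−ρ_Td}` and file 23's pair data (`G₀, D_j ≤ βe^{−δd}`, `V̂ ≤ Re^{−δ_Vd}`, `σ ≤ ρ₁ ≤ δ_V`, `ρ₁ + σ ≤ δ`,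
`ρ₂ + σ ≤ ρ₁`, `βRc_r² < 1`) with `ρ₂ + σ ≤ ρ_T` ⟹ `F∘(1 + V̂X̂) ≤ 1_S(y)·ε₀(1 − βRc_r²)⁻¹e^{−ρ₂d}`. [cite: Balaban1985BackgroundPropagators, (3.63)–(3.65) pp.402–403 (mechanism); Balaban1984PropagatorsII, (2.133)–(2.134) p.247 (shape)] -/
theorem hasMaj_comp_onePlusVX_out (htri : Triangle254 g) (hd : ∀ a b : g.Site, 0 ≤ g.dist a b) (hrow : RowSum g σ cr) (hσ : 0 ≤ σ) {ρ₁ ρ₂ ρT δ δV β R ε₀ : ℝ} (hβ : 0 ≤ β)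
    (hR : 0 ≤ R) (hε₀ : 0 ≤ ε₀) (hcr : 0 ≤ cr) (hσρ : σ ≤ ρ₁) (hρ₁V : ρ₁ ≤ δV) (hρ₁G : ρ₁ + σ ≤ δ) (hρ₂ : 0 ≤ ρ₂) (hρ₂₁ : ρ₂ + σ ≤ ρ₁) (hρ₂T : ρ₂ + σ ≤ ρT)
    (F : (X × ι → ℝ) →ₗ[ℝ] (X × ι → ℝ)) {S : Set g.Site}
    (hG : HasMaj (BlockNorm.ofBlocks g (liftBlk blk ι)) (BlockNorm.ofBlocks g (liftBlk blk ι)) G₀ (fun y y' => β * Real.exp (-(δ * g.dist y y'))))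
    (hD : ∀ j, HasMaj (BlockNorm.ofBlocks g (liftBlk blk ι)) (BlockNorm.ofBlocks g (liftBlk blk ι)) (D j) (fun y y' => β * Real.exp (-(δ * g.dist y y'))))
    (hV : HasMaj (BlockNorm.ofBlocks g (blkPair (liftBlk blk ι))) (BlockNorm.ofBlocks g (liftBlk blk ι)) V (fun y y' => R * Real.exp (-(δV * g.dist y y'))))
    (hq : β * (R * cr) * cr < 1)
    (hF : HasMaj (BlockNorm.ofBlocks g (liftBlk blk ι)) (BlockNorm.ofBlocks g (liftBlk blk ι)) F (fun y y' => ind S y * ind S y' * (ε₀ * Real.exp (-(ρT * g.dist y y'))))) :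
    HasMaj (BlockNorm.ofBlocks g (liftBlk blk ι)) (BlockNorm.ofBlocks g (liftBlk blk ι)) (F ∘ₗ (LinearMap.id + V ∘ₗ bgPropV (stack G₀ D) V))
      (fun y y' => ind S y * (ε₀ * (1 - β * (R * cr) * cr)⁻¹ * Real.exp (-(ρ₂ * g.dist y y')))) := by
  have hS := hasMaj_stack (liftBlk blk ι) (fun _ _ => mul_nonneg hβ (Real.exp_nonneg _)) hG hD
  have hVX := hasMaj_V_bgPropVE (liftBlk blk ι) (blkPair (liftBlk blk ι)) htri hd hrow hσ hβ hR hcr hσρ hρ₁V hρ₁G hρ₂ hρ₂₁ hS hV hq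
  have hβX : 0 ≤ R * (β * (1 - β * (R * cr) * cr)⁻¹) * cr := mul_nonneg (mul_nonneg hR (mul_nonneg hβ (inv_nonneg.2 (by linarith)))) hcr
  have t2 := hasMaj_comp_exp_out (liftBlk blk ι) htri hd hrow hε₀ hβX hρ₂ le_rfl hρ₂T hF hVX
  have t1 : HasMaj (BlockNorm.ofBlocks g (liftBlk blk ι)) (BlockNorm.ofBlocks g (liftBlk blk ι)) F (fun y y' => ind S y * (ε₀ * Real.exp (-(ρ₂ * g.dist y y')))) := by
    refine hF.mono fun a b => ?_
    have hexp : Real.exp (-(ρT * g.dist a b)) ≤ Real.exp (-(ρ₂ * g.dist a b)) := Real.exp_le_exp.mpr (by nlinarith [hd a b])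
    have h1 : ind S b ≤ 1 := by unfold ind; split_ifs <;> norm_num
    calc ind S a * ind S b * (ε₀ * Real.exp (-(ρT * g.dist a b))) ≤ ind S a * 1 * (ε₀ * Real.exp (-(ρ₂ * g.dist a b))) :=
          mul_le_mul (mul_le_mul_of_nonneg_left h1 (ind_nonneg _ _)) (mul_le_mul_of_nonneg_left hexp hε₀) (mul_nonneg hε₀ (Real.exp_nonneg _))
            (mul_nonneg (ind_nonneg _ _) zero_le_one)
      _ = _ := by ring
  rw [LinearMap.comp_add, LinearMap.comp_id]
  refine (t1.add t2).mono fun y y' => le_of_eq ?_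
  rw [← neumannFactor_eq (t := ε₀) hq]
  ring

variable {N : (X × ι → ℝ) →ₗ[ℝ] (X × ι → ℝ)} {χtX : X → ℝ}

/-- ★★ **FILE 32's `hE` ROW FOR THE DRESSED SMOOTH-CUT CUBE**: with `G₀ := M_χ̃N_□`, the tail's two-sided letter `(−M_hN_LM_{1−χ̃})∘N_□ ≤ 1_S1_S·ε₀e^{−ρ_Td}` (DISPLAYED — dag-n15-a's images
geometry ∕ FILE 68's far sandwich, `ε₀ ~ e^{−δ′m₀}`), and file 23's pair data ⟹ the locality defect `E_□ = ((−M_hN_LM_{1−χ̃})∘N_□)∘(1 + 𝒱X) ≤ 1_S(y)·ε₀(1 − βRc_r²)⁻¹e^{−ρ₂d}`.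
[cite: Balaban1984PropagatorsI, (1.120)–(1.123) p.37, (1.128) p.38 (mechanism); Balaban1984PropagatorsII, (2.133)–(2.135) p.247 (shape)] -/
theorem hasMaj_dressedTail_out (htri : Triangle254 g) (hd : ∀ a b : g.Site, 0 ≤ g.dist a b) (hrow : RowSum g σ cr) (hσ : 0 ≤ σ) {ρ₁ ρ₂ ρT δ δV β R ε₀ : ℝ} (hβ : 0 ≤ β)
    (hR : 0 ≤ R) (hε₀ : 0 ≤ ε₀) (hcr : 0 ≤ cr) (hσρ : σ ≤ ρ₁) (hρ₁V : ρ₁ ≤ δV) (hρ₁G : ρ₁ + σ ≤ δ) (hρ₂ : 0 ≤ ρ₂) (hρ₂₁ : ρ₂ + σ ≤ ρ₁) (hρ₂T : ρ₂ + σ ≤ ρT)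
    {NL : (X × ι → ℝ) →ₗ[ℝ] (X × ι → ℝ)} {h : X × ι → ℝ} {S : Set g.Site} (hDq : ∀ j, D j = Dq j ∘ₗ (mulOp (fun p : X × ι => χtX p.1) ∘ₗ N))
    (hG : HasMaj (BlockNorm.ofBlocks g (liftBlk blk ι)) (BlockNorm.ofBlocks g (liftBlk blk ι)) (mulOp (fun p : X × ι => χtX p.1) ∘ₗ N) (fun y y' => β * Real.exp (-(δ * g.dist y y'))))
    (hD : ∀ j, HasMaj (BlockNorm.ofBlocks g (liftBlk blk ι)) (BlockNorm.ofBlocks g (liftBlk blk ι)) (D j) (fun y y' => β * Real.exp (-(δ * g.dist y y'))))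
    (hV : HasMaj (BlockNorm.ofBlocks g (blkPair (liftBlk blk ι))) (BlockNorm.ofBlocks g (liftBlk blk ι)) V (fun y y' => R * Real.exp (-(δV * g.dist y y'))))
    (hq : β * (R * cr) * cr < 1)
    (hT : HasMaj (BlockNorm.ofBlocks g (liftBlk blk ι)) (BlockNorm.ofBlocks g (liftBlk blk ι)) ((-(mulOp h ∘ₗ NL ∘ₗ mulOp (1 - fun p : X × ι => χtX p.1))) ∘ₗ N)
      (fun y y' => ind S y * ind S y' * (ε₀ * Real.exp (-(ρT * g.dist y y'))))) :
    HasMaj (BlockNorm.ofBlocks g (liftBlk blk ι)) (BlockNorm.ofBlocks g (liftBlk blk ι))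
      (((-(mulOp h ∘ₗ NL ∘ₗ mulOp (1 - fun p : X × ι => χtX p.1))) ∘ₗ N) ∘ₗ
        (LinearMap.id + (V ∘ₗ stack LinearMap.id Dq) ∘ₗ (projO none ∘ₗ bgPropV (stack (mulOp (fun p : X × ι => χtX p.1) ∘ₗ N) D) V)))
      (fun y y' => ind S y * (ε₀ * (1 - β * (R * cr) * cr)⁻¹ * Real.exp (-(ρ₂ * g.dist y y')))) := by
  obtain ⟨hunit, -⟩ := hasMaj_dressedV_pair blk htri hd hrow hσ hβ hR hcr hσρ hρ₁V hρ₁G hρ₂ hρ₂₁ hG hD hV hq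
  have e1 : LinearMap.id + (V ∘ₗ stack LinearMap.id Dq) ∘ₗ (projO none ∘ₗ bgPropV (stack (mulOp (fun p : X × ι => χtX p.1) ∘ₗ N) D) V) =
      LinearMap.id + V ∘ₗ bgPropV (stack (mulOp (fun p : X × ι => χtX p.1) ∘ₗ N) D) V := by rw [← V_comp_dressedV hDq hunit]
  rw [e1]
  exact hasMaj_comp_onePlusVX_out blk htri hd hrow hσ hβ hR hε₀ hcr hσρ hρ₁V hρ₁G hρ₂ hρ₂₁ hρ₂T _ hG hD hV hq hT

end Rows

/-! ## §3 The dressed tail's η-defect -/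

section Defects

variable {X X' ι J : Type} [Fintype X] [Fintype X'] [DecidableEq X] [DecidableEq X'] [Fintype ι] [DecidableEq ι] [Fintype J] [DecidableEq J] {g : B6.Geometry}
  (blk : X → g.Site) (π : X' → X) {σ cr : ℝ} {G₀ : (X × ι → ℝ) →ₗ[ℝ] (X × ι → ℝ)} {D Dq : J ⊕ J → (X × ι → ℝ) →ₗ[ℝ] (X × ι → ℝ)}
  {V : ((X × ι) × Option (J ⊕ J) → ℝ) →ₗ[ℝ] (X × ι → ℝ)} {G₀' : (X' × ι → ℝ) →ₗ[ℝ] (X' × ι → ℝ)} {D' Dq' : J ⊕ J → (X' × ι → ℝ) →ₗ[ℝ] (X' × ι → ℝ)}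
  {V' : ((X' × ι) × Option (J ⊕ J) → ℝ) →ₗ[ℝ] (X' × ι → ℝ)}

/-- ★★ **THE η-DEFECT OF ANY OUTPUT-LOCALIZED ROW THROUGH `1 + V̂X̂`** (pair letters displayed, as in files 28∕30): fine row `F′ ≤ 1_S1_S·ε₀e^{−ρ_Td}`, defect `𝔇(F′, F) ≤ 1_S1_S·r_Fe^{−ρ_Td}`, pair
`X̂ ≤ Ae^{−ρ₂d}`, `𝔇(X̂′, X̂) ≤ A_De^{−ρ₂d}`, `V̂, V̂′ ≤ Re^{−δ_Vd}`, `𝔇(V̂′, V̂) ≤ oe^{−δ_Vd}`, rates `σ ≤ ρ₂`, `ρ₂ + σ ≤ δ_V`, `ρ₂ + σ ≤ ρ_T` ⟹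
`𝔇(F′(1 + V̂′X̂′), F(1 + V̂X̂)) ≤ 1_S(y)·(ε₀(RA_D + oA)c_r² + r_F(1 + RAc_r²))·e^{−ρ₂d}`. [cite: Balaban1985BackgroundPropagators, Thm 3.14 pp.426–427 (template); Balaban1984PropagatorsII, (2.52)–(2.56) pp.232–233] -/
theorem hasMaj_idef_comp_onePlusVX_out (htri : Triangle254 g) (hd : ∀ a b : g.Site, 0 ≤ g.dist a b) (hrow : RowSum g σ cr) (hσ : 0 ≤ σ) (hcr : 0 ≤ cr) {ρ₂ ρT δV R o ε₀ rF A AD : ℝ}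
    (hR : 0 ≤ R) (ho : 0 ≤ o) (hε₀ : 0 ≤ ε₀) (hrF : 0 ≤ rF) (hA : 0 ≤ A) (hAD : 0 ≤ AD) (hσρ : σ ≤ ρ₂) (hρ₂V : ρ₂ + σ ≤ δV) (hρ₂T : ρ₂ + σ ≤ ρT)
    (F : (X × ι → ℝ) →ₗ[ℝ] (X × ι → ℝ)) (F' : (X' × ι → ℝ) →ₗ[ℝ] (X' × ι → ℝ)) {S : Set g.Site}
    (hF' : HasMaj (BlockNorm.ofBlocks g (liftBlk (blk ∘ π) ι)) (BlockNorm.ofBlocks g (liftBlk (blk ∘ π) ι)) F' (fun y y' => ind S y * ind S y' * (ε₀ * Real.exp (-(ρT * g.dist y y')))))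
    (hDF : HasMaj (BlockNorm.ofBlocks g (liftBlk blk ι)) (BlockNorm.ofBlocks g (liftBlk (blk ∘ π) ι)) (idef (pull (liftMap π ι)) (pull (liftMap π ι)) F' F)
      (fun y y' => ind S y * ind S y' * (rF * Real.exp (-(ρT * g.dist y y')))))
    (hX : HasMaj (BlockNorm.ofBlocks g (liftBlk blk ι)) (BlockNorm.ofBlocks g (blkPair (liftBlk blk ι))) (bgPropV (stack G₀ D) V) (fun y y' => A * Real.exp (-(ρ₂ * g.dist y y'))))
    (hDX : HasMaj (BlockNorm.ofBlocks g (liftBlk blk ι)) (BlockNorm.ofBlocks g (blkPair (liftBlk (blk ∘ π) ι)))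
      (idef (pull (liftMap π ι)) (pull (liftPair (liftMap π ι))) (bgPropV (stack G₀' D') V') (bgPropV (stack G₀ D) V)) (fun y y' => AD * Real.exp (-(ρ₂ * g.dist y y'))))
    (hV : HasMaj (BlockNorm.ofBlocks g (blkPair (liftBlk blk ι))) (BlockNorm.ofBlocks g (liftBlk blk ι)) V (fun y y' => R * Real.exp (-(δV * g.dist y y'))))
    (hV' : HasMaj (BlockNorm.ofBlocks g (blkPair (liftBlk (blk ∘ π) ι))) (BlockNorm.ofBlocks g (liftBlk (blk ∘ π) ι)) V' (fun y y' => R * Real.exp (-(δV * g.dist y y'))))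
    (hDV : HasMaj (BlockNorm.ofBlocks g (blkPair (liftBlk blk ι))) (BlockNorm.ofBlocks g (liftBlk (blk ∘ π) ι))
      (idef (pull (liftPair (liftMap π ι))) (pull (liftMap π ι)) V' V) (fun y y' => o * Real.exp (-(δV * g.dist y y')))) :
    HasMaj (BlockNorm.ofBlocks g (liftBlk blk ι)) (BlockNorm.ofBlocks g (liftBlk (blk ∘ π) ι))
      (idef (pull (liftMap π ι)) (pull (liftMap π ι)) (F' ∘ₗ (LinearMap.id + V' ∘ₗ bgPropV (stack G₀' D') V')) (F ∘ₗ (LinearMap.id + V ∘ₗ bgPropV (stack G₀ D) V)))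
      (fun y y' => ind S y * ((ε₀ * (R * AD + o * A) * cr * cr + rF * (1 + R * A * cr * cr)) * Real.exp (-(ρ₂ * g.dist y y')))) := by
  have hρ₂ : 0 ≤ ρ₂ := hσ.trans hσρ
  -- the inner bracket `V̂′𝔇(X̂′, X̂) + 𝔇(V̂′, V̂)X̂ ≤ (RA_D + oA)c_r e^{−ρ₂d}` (global)
  have u1 := hasMaj_comp_exp htri hd hrow hR hAD hρ₂ le_rfl hρ₂V hV' hDX
  have u2 := hasMaj_comp_exp htri hd hrow ho hA hρ₂ le_rfl hρ₂V hDV hX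
  have hin : HasMaj (BlockNorm.ofBlocks g (liftBlk blk ι)) (BlockNorm.ofBlocks g (liftBlk (blk ∘ π) ι))
      (V' ∘ₗ idef (pull (liftMap π ι)) (pull (liftPair (liftMap π ι))) (bgPropV (stack G₀' D') V') (bgPropV (stack G₀ D) V) +
        idef (pull (liftPair (liftMap π ι))) (pull (liftMap π ι)) V' V ∘ₗ bgPropV (stack G₀ D) V)
      (fun y y' => (R * AD + o * A) * cr * Real.exp (-(ρ₂ * g.dist y y'))) := by
    refine (u1.add u2).mono fun y y' => le_of_eq ?_
    simp only [kappa_ofBlocks]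
    ring
  have p1 := hasMaj_comp_exp_out (liftBlk (blk ∘ π) ι) htri hd hrow hε₀ (by positivity : 0 ≤ (R * AD + o * A) * cr) hρ₂ le_rfl hρ₂T hF' hin
  -- `𝔇(F′, F)∘(1 + V̂X̂)`
  have hVX : HasMaj (BlockNorm.ofBlocks g (liftBlk blk ι)) (BlockNorm.ofBlocks g (liftBlk blk ι)) (V ∘ₗ bgPropV (stack G₀ D) V) (fun y y' => R * A * cr * Real.exp (-(ρ₂ * g.dist y y'))) := by
    refine (hasMaj_comp_exp htri hd hrow hR hA hρ₂ le_rfl hρ₂V hV hX).mono fun y y' => le_of_eq ?_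
    rw [kappa_ofBlocks]; ring
  have p2 := hasMaj_comp_exp_out (liftBlk blk ι) htri hd hrow hrF (by positivity : 0 ≤ R * A * cr) hρ₂ le_rfl hρ₂T hDF hVX
  have p3 : HasMaj (BlockNorm.ofBlocks g (liftBlk blk ι)) (BlockNorm.ofBlocks g (liftBlk (blk ∘ π) ι)) (idef (pull (liftMap π ι)) (pull (liftMap π ι)) F' F)
      (fun y y' => ind S y * (rF * Real.exp (-(ρ₂ * g.dist y y')))) := by
    refine hDF.mono fun a b => ?_
    have hexp : Real.exp (-(ρT * g.dist a b)) ≤ Real.exp (-(ρ₂ * g.dist a b)) := Real.exp_le_exp.mpr (by nlinarith [hd a b])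
    have h1 : ind S b ≤ 1 := by unfold ind; split_ifs <;> norm_num
    calc ind S a * ind S b * (rF * Real.exp (-(ρT * g.dist a b))) ≤ ind S a * 1 * (rF * Real.exp (-(ρ₂ * g.dist a b))) :=
          mul_le_mul (mul_le_mul_of_nonneg_left h1 (ind_nonneg _ _)) (mul_le_mul_of_nonneg_left hexp hrF) (mul_nonneg hrF (Real.exp_nonneg _))
            (mul_nonneg (ind_nonneg _ _) zero_le_one)
      _ = _ := by ring
  have p23 : HasMaj (BlockNorm.ofBlocks g (liftBlk blk ι)) (BlockNorm.ofBlocks g (liftBlk (blk ∘ π) ι))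
      (idef (pull (liftMap π ι)) (pull (liftMap π ι)) F' F ∘ₗ (LinearMap.id + V ∘ₗ bgPropV (stack G₀ D) V))
      (fun y y' => ind S y * (rF * (1 + R * A * cr * cr) * Real.exp (-(ρ₂ * g.dist y y')))) := by
    rw [LinearMap.comp_add, LinearMap.comp_id]
    refine (p3.add p2).mono fun y y' => le_of_eq ?_
    ring
  rw [idef_comp_onePlusVX_eq π F F']
  refine (p1.add p23).mono fun y y' => le_of_eq ?_
  ring

variable {N : (X × ι → ℝ) →ₗ[ℝ] (X × ι → ℝ)} {N' : (X' × ι → ℝ) →ₗ[ℝ] (X' × ι → ℝ)} {χtX : X → ℝ} {χtX' : X' → ℝ}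

/-- ★★ **FILE 32's `hDE` ROW FOR THE DRESSED SMOOTH-CUT CUBE**: the two grids' units and jets (`D = Dq∘(M_χ̃N)`, `D′ = Dq′∘(M_{χ̃′}N′)`), the tails' DISPLAYED rows (fine letter `ε₀`, defect `r_F`, two-sided over
`S`) and pair letters (`A, A_D, R, o`) ⟹ `𝔇(E′_□, E_□) ≤ 1_S(y)·(ε₀(RA_D + oA)c_r² + r_F(1 + RAc_r²))·e^{−ρ₂d}` for `E_□ = ((−M_hN_LM_{1−χ̃})∘N)∘(1 + 𝒱X)`.
[cite: Balaban1985BackgroundPropagators, Thm 3.14 pp.426–427 (template); Balaban1984PropagatorsI, (1.120)–(1.123) p.37 (shape)] -/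
theorem hasMaj_idef_dressedTail_out (htri : Triangle254 g) (hd : ∀ a b : g.Site, 0 ≤ g.dist a b) (hrow : RowSum g σ cr) (hσ : 0 ≤ σ) (hcr : 0 ≤ cr) {ρ₂ ρT δV R o ε₀ rF A AD : ℝ}
    (hR : 0 ≤ R) (ho : 0 ≤ o) (hε₀ : 0 ≤ ε₀) (hrF : 0 ≤ rF) (hA : 0 ≤ A) (hAD : 0 ≤ AD) (hσρ : σ ≤ ρ₂) (hρ₂V : ρ₂ + σ ≤ δV) (hρ₂T : ρ₂ + σ ≤ ρT)
    {NL : (X × ι → ℝ) →ₗ[ℝ] (X × ι → ℝ)} {NL' : (X' × ι → ℝ) →ₗ[ℝ] (X' × ι → ℝ)} {h : X × ι → ℝ} {h' : X' × ι → ℝ} {S : Set g.Site}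
    (hDq : ∀ j, D j = Dq j ∘ₗ (mulOp (fun p : X × ι => χtX p.1) ∘ₗ N)) (hDq' : ∀ j, D' j = Dq' j ∘ₗ (mulOp (fun p : X' × ι => χtX' p.1) ∘ₗ N'))
    (hunit : IsUnit (1 - LinearMap.toMatrix' (stack (mulOp (fun p : X × ι => χtX p.1) ∘ₗ N) D ∘ₗ V)))
    (hunit' : IsUnit (1 - LinearMap.toMatrix' (stack (mulOp (fun p : X' × ι => χtX' p.1) ∘ₗ N') D' ∘ₗ V')))
    (hF' : HasMaj (BlockNorm.ofBlocks g (liftBlk (blk ∘ π) ι)) (BlockNorm.ofBlocks g (liftBlk (blk ∘ π) ι)) ((-(mulOp h' ∘ₗ NL' ∘ₗ mulOp (1 - fun p : X' × ι => χtX' p.1))) ∘ₗ N')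
      (fun y y' => ind S y * ind S y' * (ε₀ * Real.exp (-(ρT * g.dist y y')))))
    (hDF : HasMaj (BlockNorm.ofBlocks g (liftBlk blk ι)) (BlockNorm.ofBlocks g (liftBlk (blk ∘ π) ι))
      (idef (pull (liftMap π ι)) (pull (liftMap π ι)) ((-(mulOp h' ∘ₗ NL' ∘ₗ mulOp (1 - fun p : X' × ι => χtX' p.1))) ∘ₗ N')
        ((-(mulOp h ∘ₗ NL ∘ₗ mulOp (1 - fun p : X × ι => χtX p.1))) ∘ₗ N)) (fun y y' => ind S y * ind S y' * (rF * Real.exp (-(ρT * g.dist y y')))))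
    (hX : HasMaj (BlockNorm.ofBlocks g (liftBlk blk ι)) (BlockNorm.ofBlocks g (blkPair (liftBlk blk ι))) (bgPropV (stack (mulOp (fun p : X × ι => χtX p.1) ∘ₗ N) D) V)
      (fun y y' => A * Real.exp (-(ρ₂ * g.dist y y'))))
    (hDX : HasMaj (BlockNorm.ofBlocks g (liftBlk blk ι)) (BlockNorm.ofBlocks g (blkPair (liftBlk (blk ∘ π) ι)))
      (idef (pull (liftMap π ι)) (pull (liftPair (liftMap π ι))) (bgPropV (stack (mulOp (fun p : X' × ι => χtX' p.1) ∘ₗ N') D') V')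
        (bgPropV (stack (mulOp (fun p : X × ι => χtX p.1) ∘ₗ N) D) V)) (fun y y' => AD * Real.exp (-(ρ₂ * g.dist y y'))))
    (hV : HasMaj (BlockNorm.ofBlocks g (blkPair (liftBlk blk ι))) (BlockNorm.ofBlocks g (liftBlk blk ι)) V (fun y y' => R * Real.exp (-(δV * g.dist y y'))))
    (hV' : HasMaj (BlockNorm.ofBlocks g (blkPair (liftBlk (blk ∘ π) ι))) (BlockNorm.ofBlocks g (liftBlk (blk ∘ π) ι)) V' (fun y y' => R * Real.exp (-(δV * g.dist y y'))))
    (hDV : HasMaj (BlockNorm.ofBlocks g (blkPair (liftBlk blk ι))) (BlockNorm.ofBlocks g (liftBlk (blk ∘ π) ι))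
      (idef (pull (liftPair (liftMap π ι))) (pull (liftMap π ι)) V' V) (fun y y' => o * Real.exp (-(δV * g.dist y y')))) :
    HasMaj (BlockNorm.ofBlocks g (liftBlk blk ι)) (BlockNorm.ofBlocks g (liftBlk (blk ∘ π) ι))
      (idef (pull (liftMap π ι)) (pull (liftMap π ι))
        (((-(mulOp h' ∘ₗ NL' ∘ₗ mulOp (1 - fun p : X' × ι => χtX' p.1))) ∘ₗ N') ∘ₗ
          (LinearMap.id + (V' ∘ₗ stack LinearMap.id Dq') ∘ₗ (projO none ∘ₗ bgPropV (stack (mulOp (fun p : X' × ι => χtX' p.1) ∘ₗ N') D') V')))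
        (((-(mulOp h ∘ₗ NL ∘ₗ mulOp (1 - fun p : X × ι => χtX p.1))) ∘ₗ N) ∘ₗ
          (LinearMap.id + (V ∘ₗ stack LinearMap.id Dq) ∘ₗ (projO none ∘ₗ bgPropV (stack (mulOp (fun p : X × ι => χtX p.1) ∘ₗ N) D) V))))
      (fun y y' => ind S y * ((ε₀ * (R * AD + o * A) * cr * cr + rF * (1 + R * A * cr * cr)) * Real.exp (-(ρ₂ * g.dist y y')))) := by
  have e1 : LinearMap.id + (V ∘ₗ stack LinearMap.id Dq) ∘ₗ (projO none ∘ₗ bgPropV (stack (mulOp (fun p : X × ι => χtX p.1) ∘ₗ N) D) V) =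
      LinearMap.id + V ∘ₗ bgPropV (stack (mulOp (fun p : X × ι => χtX p.1) ∘ₗ N) D) V := by rw [← V_comp_dressedV hDq hunit]
  have e1' : LinearMap.id + (V' ∘ₗ stack LinearMap.id Dq') ∘ₗ (projO none ∘ₗ bgPropV (stack (mulOp (fun p : X' × ι => χtX' p.1) ∘ₗ N') D') V') =
      LinearMap.id + V' ∘ₗ bgPropV (stack (mulOp (fun p : X' × ι => χtX' p.1) ∘ₗ N') D') V' := by rw [← V_comp_dressedV hDq' hunit']
  rw [e1, e1']
  exact hasMaj_idef_comp_onePlusVX_out blk π htri hd hrow hσ hcr hR ho hε₀ hrF hA hAD hσρ hρ₂V hρ₂T _ _ hF' hDF hX hDX hV hV' hDV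

end Defects

end Summit.QuantumFields.YangMills.BalabanUVNodes.N15.CurvedSpecies

end
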